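import Summits.ABC.IUTFork.LanaRealHull
import Summits.ABC.IUTFork.LanaMeasureContainer
import HarnessLib

/-!
# L-LANA objects V septies: skel XVII's volume container over the REAL `(⊕_j K_j, μ_Λ)`; hull admissibility DISCHARGED

Record-only file (D-0012) of the abc-iut cell (seat abc-iut-c312-4, L-LANA level; bridge N15 ↔ skel XVII over the
real container); TAKES NO SIDE on [IUTchIII] Cor. 3.12. Gen-0's `LanaMeasureContainer.lean` made ANY measure space
with ANY closure operator a `VolumeContainer` (XVII) and built a `Cor312Setting` from measure-level data with the
admissibility of the hull of `⋃_λ U_λ` ASSUMED (`hhull`, "as in XVII"). Over the real container of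
`LanaRealHull.lean` — `⊕_j K_j` with the normalised Haar measure `μ_Λ` (S2 `IntegralStructure.haar`) and S2's
`hullClosureOperator` ([IUTchIII] Rmk. 3.9.5 (i)(ii)) — that datum is a THEOREM for bounded nondegenerate unions
(`hull_adm`, from `hullRegion`), whence `realCor312Setting` with no admissibility input; XVII's theorems
(`logvol_U_le_negLogTheta`, the three readings, `cor312_of_representedVol`, …) then speak about Haar measure on
`⊕_j K_j`. [cite: LANA2026Report, §5.2 (d)(e) p. 29, §8.1 (c),(f),(h) pp. 40–41]
[cite: Mochizuki2012, IUTchIII Rmk. 3.9.5 (i) p. 127] NOT here: any judgement.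
-/

noncomputable section

open MeasureTheory Set Metric Bornology
open Literature.IUT.LogVolume

namespace Summit.ABC
namespace IUTFork

variable {J : Type} [Fintype J] (K : J → Type) [∀ j, NontriviallyNormedField (K j)]
  [MeasurableSpace (Π j, K j)] [BorelSpace (Π j, K j)] (Λ : IntegralStructure (Π j, K j))

/-! ## 3. Skel XVII over the real container: the hull of a bounded nondegenerate union is admissible -/

/-- **The real volume container** (XVII `VolumeContainer`): carrier `⊕_j K_j`, admissible = measurable of finite
nonzero `μ_Λ`-measure, `ln ν̄ = log μ_Λ`, hull = S2's `hullClosureOperator` (gen-0 `measureContainer`).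
[cite: LANA2026Report, §5.2 (d)(e) p. 29] -/
def realContainer : VolumeContainer := measureContainer Λ.haar (hullClosureOperator K)

/-- The hull operator of the real container is S2's `holomorphicHull`. [folklore] -/
theorem realContainer_hull_apply (U : Set (Π j, K j)) : (realContainer K Λ).hull U = holomorphicHull K U := rfl

variable [∀ j, ProperSpace (K j)] [∀ j, IsUltrametricDist (K j)]

/-- **Hull admissibility DISCHARGED**: for `U` bounded and nondegenerate, `U^{hol}` is an admissible region of the
real container (the datum `hhull` of gen-0 `LanaMeasureContainer.cor312Setting`; skel XVII asks it of a
container). [cite: LANA2026Report, §8.1 (h) p. 41] [cite: Mochizuki2012, IUTchIII Rmk. 3.9.5 (i) p. 127] -/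
theorem hull_adm (U : Set (Π j, K j)) (hU : IsBounded U) (hnd : IsNondegenerate K U) :
    (realContainer K Λ).Adm ((realContainer K Λ).hull U) :=
  Region.adm Λ.haar (hullClosureOperator K) (hullRegion K Λ U hU hnd)

/-- **A `Cor312Setting` (XVII) over the real container with NO admissibility datum**: possible images `U_λ` and
the `q`-image given as regions whose union is bounded and nondegenerate; the hull is S2's and its admissibility
is `hull_adm`. Then XVII's `logvol_U_le_negLogTheta`, the three readings, `cor312_of_representedVol`, … apply to
`(⊕_j K_j, μ_Λ)`. [cite: LANA2026Report, §8.1 (c),(f),(h) pp. 40–41] -/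
def realCor312Setting {Idx : Type} (U : Idx → Region Λ.haar) (Q : Region Λ.haar)
    (hb : IsBounded (⋃ i, (U i).carrier)) (hnd : IsNondegenerate K (⋃ i, (U i).carrier)) : Cor312Setting :=
  cor312Setting Λ.haar (hullClosureOperator K) U Q (hull_adm K Λ _ hb hnd)

/-- The real setting's `−|log(Θ)|` is `log μ_Λ((⋃_λ U_λ)^{hol})`. [cite: LANA2026Report, §8.1 (h) p. 41] -/
theorem realCor312Setting_negLogTheta {Idx : Type} (U : Idx → Region Λ.haar) (Q : Region Λ.haar)
    (hb : IsBounded (⋃ i, (U i).carrier)) (hnd : IsNondegenerate K (⋃ i, (U i).carrier)) :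
    (realCor312Setting K Λ U Q hb hnd).negLogTheta = Λ.logVolume (holomorphicHull K (⋃ i, (U i).carrier)) :=
  rfl

end IUTFork

end Summit.ABC

end
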